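import Literature.Computability.AlgebraicComplexity.BorderRankMatMulThreeTripleDual
import Literature.Computability.AlgebraicComplexity.BorderRankMatMulThreeSigma
import Literature.Computability.AlgebraicComplexity.BorderApolarityTriples
import HarnessLib

/-!
# Borel-fixed candidates of `⟨3,3,3⟩`: soundness of the `(111)` test procedure

Topic `Literature/Computability/AlgebraicComplexity`. For `E₁ ≤ dualModel p₁`,
`E₂ ∘ σ₂ ≤ dualModel p₂`, `E₃ ∘ σ₃ ≤ dualModel p₃` (`BorderRankMatMulThreeTripleDual.lean`):

* every 3-array `x` in the `(111)`-test space `tripleInter E₁ E₂ E₃` vanishes at the killed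
  coordinates (`MatMul3.apply_eq_zero_of_killed`) and is annihilated by every legitimate pulled
  relation (`MatMul3.ev_toFunc_eq_zero`) of `BorderRankMatMulThreeTriple.lean`;
* a family of sparse functionals with non-zero pivots and vanishing at later pivots is linearly
  independent, so a subspace they annihilate has dimension `≤ 729 - #family`
  (`MatMul3.finrank_le_of_triangular`);
* the checker `Ker.certOK111` guarantees this for the killed unit functionals followed by the
  selected relations; hence **`dim tripleInter E₁ E₂ E₃ ≤ Ker.bound111 p₁ p₂ p₃`**
  (`MatMul3.finrank_tripleInter_le_bound111`).

## References

* A. Conner, A. Harper, J. M. Landsberg, *New lower bounds for matrix multiplication and `det₃`*,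
  Forum Math. Pi 11 (2023) e17, arXiv:1911.07981 — §3 (ii), §6. [ConnerHarperLandsberg2023]
-/

noncomputable section

open scoped BigOperators

open Matrix

namespace Literature.Computability.AlgebraicComplexity

namespace BorderApolarity

namespace MatMul3

universe u

variable {K : Type u} [Field K]

/-! ## Decoding facts (kernel-checked on the finite ranges) -/

/-- Table lookup of `offRoot`. [folklore] -/
theorem offLook_offTab (p : List (List (ℕ × ℕ) × ℕ)) {jk ii : ℕ} (hjk : jk < 9) (hii : ii < 9) :
    Ker.offLook (Ker.offTab p) jk ii = Ker.offRoot p jk (ii / 3) (ii % 3) := by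
  simp only [Ker.offLook, Ker.offTab, List.getD_eq_getElem?_getD, List.getElem?_map,
    List.getElem?_range hjk, List.getElem?_range hii, Option.map_some, Option.getD_some]

/-- The coordinates of a triple code, as the indices the procedure computes. [folklore] -/
theorem tdecode_spec : ∀ s : Fin 729,
    (((tdecode s).1.1 : ℕ) = s / 81 / 3 ∧ ((tdecode s).1.2 : ℕ) = s / 81 % 3) ∧
    (((tdecode s).2.1.1 : ℕ) = s / 9 % 9 / 3 ∧ ((tdecode s).2.1.2 : ℕ) = s / 9 % 9 % 3) ∧
    (((tdecode s).2.2.1 : ℕ) = s % 9 / 3 ∧ ((tdecode s).2.2.2 : ℕ) = s % 9 % 3) := by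
  decide +kernel

/-- The same for a natural number code `< 729`. [folklore] -/
theorem tdecode_spec' {s : ℕ} (hs : s < 729) :
    (((tdecode s).1.1 : ℕ) = s / 81 / 3 ∧ ((tdecode s).1.2 : ℕ) = s / 81 % 3) ∧
    (((tdecode s).2.1.1 : ℕ) = s / 9 % 9 / 3 ∧ ((tdecode s).2.1.2 : ℕ) = s / 9 % 9 % 3) ∧
    (((tdecode s).2.2.1 : ℕ) = s % 9 / 3 ∧ ((tdecode s).2.2.2 : ℕ) = s % 9 % 3) :=
  tdecode_spec ⟨s, hs⟩

/-- Decoding the codes of a type-`1` relation: `((idx,k),(idx,j),c)`. [folklore] -/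
theorem tdecode_relCode₁ : ∀ (sl jk : Fin 9) (idx : Fin 3),
    tdecode (Ker.relCode 1 sl jk idx) =
      ((idx, ⟨(jk : ℕ) % 3, Nat.mod_lt _ (by decide)⟩),
        (idx, ⟨(jk : ℕ) / 3 % 3, Nat.mod_lt _ (by decide)⟩), decode9 sl) := by
  decide +kernel

/-- Decoding the codes of a type-`2` relation: `(a,(rev k, idx),(idx, rev j))`. [folklore] -/
theorem tdecode_relCode₂ : ∀ (sl jk : Fin 9) (idx : Fin 3),
    tdecode (Ker.relCode 2 sl jk idx) =
      (decode9 sl, (Fin.rev ⟨(jk : ℕ) % 3, Nat.mod_lt _ (by decide)⟩, idx),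
        (idx, Fin.rev ⟨(jk : ℕ) / 3 % 3, Nat.mod_lt _ (by decide)⟩)) := by
  decide +kernel

/-- Decoding the codes of a type-`3` relation: `((k,idx), b, (rev j, idx))`. [folklore] -/
theorem tdecode_relCode₃ : ∀ (sl jk : Fin 9) (idx : Fin 3),
    tdecode (Ker.relCode 3 sl jk idx) =
      ((⟨(jk : ℕ) % 3, Nat.mod_lt _ (by decide)⟩, idx), decode9 sl,
        (Fin.rev ⟨(jk : ℕ) / 3 % 3, Nat.mod_lt _ (by decide)⟩, idx)) := by
  decide +kernel

/-- The codes of a relation are `< 729`. [folklore] -/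
theorem relCode_lt : ∀ (m : Fin 4) (sl jk : Fin 9) (idx : Fin 3), Ker.relCode m sl jk idx < 729 := by
  decide +kernel

/-! ## Vanishing on the `(111)`-test space -/

section Vanishing

variable {p₁ p₂ p₃ : List (List (ℕ × ℕ) × ℕ)} {E₁ E₂ E₃ : Submodule K (I9' × I9' → K)}
  {x : I9' × I9' × I9' → K}

/-- The `C`-slices lie in the first dual model. [folklore] -/
theorem slice₁_mem_dualModel (h₁ : E₁ ≤ dualModel p₁) (hx : x ∈ tripleInter E₁ E₂ E₃) (c : I9') :
    (fun ab : I9' × I9' => x (ab.1, ab.2, c)) ∈ dualModel (K := K) p₁ :=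
  h₁ ((mem_tripleInter.1 hx).1 c)

/-- The `A`-slices, relabeled by `σ₂`, lie in the second dual model. [folklore] -/
theorem slice₂_mem_dualModel (h₂ : E₂.map (LinearMap.funLeft K K σ₂) ≤ dualModel p₂)
    (hx : x ∈ tripleInter E₁ E₂ E₃) (a : I9') :
    (fun ab : I9' × I9' => x (a, (σ₂ ab).1, (σ₂ ab).2)) ∈ dualModel (K := K) p₂ :=
  h₂ ⟨sliceA a x, (mem_tripleInter.1 hx).2.1 a, rfl⟩

/-- The `B`-slices, relabeled by `σ₃`, lie in the third dual model. [folklore] -/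
theorem slice₃_mem_dualModel (h₃ : E₃.map (LinearMap.funLeft K K σ₃) ≤ dualModel p₃)
    (hx : x ∈ tripleInter E₁ E₂ E₃) (b : I9') :
    (fun ab : I9' × I9' => x ((σ₃ ab).1, b, (σ₃ ab).2)) ∈ dualModel (K := K) p₃ :=
  h₃ ⟨sliceB b x, (mem_tripleInter.1 hx).2.2 b, rfl⟩

variable (h₁ : E₁ ≤ dualModel p₁) (h₂ : E₂.map (LinearMap.funLeft K K σ₂) ≤ dualModel p₂)
  (h₃ : E₃.map (LinearMap.funLeft K K σ₃) ≤ dualModel p₃) (hx : x ∈ tripleInter E₁ E₂ E₃)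
include h₁ h₂ h₃ hx

/-- **A 3-array in the `(111)`-test space vanishes at the killed coordinates.**
[cite: ConnerHarperLandsberg2023, §3 (ii)] -/
theorem apply_eq_zero_of_killed {s : ℕ} (hs : s < 729) (hk : Ker.killed p₁ p₂ p₃ s = true) :
    x (tdecode s) = 0 := by
  obtain ⟨⟨eA1, eA2⟩, ⟨eB1, eB2⟩, ⟨eC1, eC2⟩⟩ := tdecode_spec' hs
  set A := (tdecode s).1 with hA
  set B := (tdecode s).2.1 with hB
  set C := (tdecode s).2.2 with hC
  have hxs : x (tdecode s) = x (A, B, C) := by rw [hA, hB, hC]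
  rw [hxs]
  rw [Ker.killed, Ker.killedT, Bool.or_eq_true, Bool.or_eq_true,
    offLook_offTab _ (by omega) (by omega), offLook_offTab _ (by omega) (by omega),
    offLook_offTab _ (by omega) (by omega)] at hk
  rcases hk with (hk | hk) | hk
  · -- killed by `S₁`: pair `(a,b)`, block `(b.2, a.2)`, position `(a.1, b.1)`
    have h := (slice₁_mem_dualModel h₁ hx C).1 B.2 A.2 A.1 B.1 (by
      rw [eA1, eA2, eB1, eB2]; convert hk using 2 <;> omega)
    simpa [blk] using h
  · -- killed by `S₂` through `σ₂`: block `(rev c.2, rev b.1)`, position `(b.2, c.1)`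
    have h := (slice₂_mem_dualModel h₂ hx A).1 C.2.rev B.1.rev B.2 C.1 (by
      rw [Fin.val_rev, Fin.val_rev, eB1, eB2, eC1, eC2]; convert hk using 2 <;> omega)
    simpa [blk, σ₂, f₂, g₂, Fin.rev_rev] using h
  · -- killed by `S₃` through `σ₃`: block `(rev c.1, a.1)`, position `(a.2, c.2)`
    have h := (slice₃_mem_dualModel h₃ hx B).1 C.1.rev A.1 A.2 C.2 (by
      rw [Fin.val_rev, eA1, eA2, eC1, eC2]; convert hk using 2 <;> omega)
    simpa [blk, σ₃, f₃, g₃, Fin.rev_rev] using h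

/-- **A 3-array in the `(111)`-test space is annihilated by every legitimate pulled relation.**
[cite: ConnerHarperLandsberg2023, §3 (ii)] -/
theorem ev_toFunc_eq_zero (q : Ker.Sel) (hq : q.legit p₁ p₂ p₃ = true) :
    Ker.TFunc.ev (q.toFunc p₁ p₂ p₃) x = 0 := by
  obtain ⟨m, sl, jk, ri⟩ := q
  simp only [Ker.Sel.legit, Bool.and_eq_true, decide_eq_true_eq] at hq
  obtain ⟨⟨⟨⟨hm1, hm3⟩, hsl⟩, hjk⟩, hri⟩ := hq
  -- the relation and its membership
  set p := (if m = 1 then p₁ else if m = 2 then p₂ else p₃) with hp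
  set r := (Ker.relsOf p jk).getD ri [] with hr
  have hrmem : r ∈ Ker.relsOf p jk := by
    rw [hr, List.getD_eq_getElem?_getD, List.getElem?_eq_getElem hri, Option.getD_some]
    exact List.getElem_mem hri
  set j : Fin 3 := ⟨jk / 3 % 3, Nat.mod_lt _ (by decide)⟩ with hj
  set k : Fin 3 := ⟨jk % 3, Nat.mod_lt _ (by decide)⟩ with hk
  have hjk' : 3 * (j : ℕ) + k = jk := by simp only [hj, hk]; omega
  have hrmem' : r ∈ Ker.relsOf p (3 * (j : ℕ) + k) := by rwa [hjk']
  -- expand the value: three terms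
  have hev : Ker.TFunc.ev (Ker.Sel.toFunc p₁ p₂ p₃ ⟨m, sl, jk, ri⟩) x =
      ∑ idx : Fin 3, ((r.getD idx 0 : ℤ) : K) * x (tdecode (Ker.relCode m sl jk idx)) := by
    simp only [Ker.TFunc.ev, Ker.Sel.toFunc, ← hp, ← hr, Fin.sum_univ_three, Fin.val_zero,
      Fin.val_one, Fin.val_two, show List.range 3 = [0, 1, 2] from rfl, List.map_cons, List.map_nil,
      List.sum_cons, List.sum_nil]
    ring
  rw [hev]
  have hm : m = 1 ∨ m = 2 ∨ m = 3 := by omega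
  rcases hm with rfl | rfl | rfl
  · have hp1 : p = p₁ := by rw [hp]; rfl
    have key := (slice₁_mem_dualModel h₁ hx (decode9 sl)).2 j k r (hp1 ▸ hrmem')
    refine Eq.trans (Finset.sum_congr rfl fun idx _ => ?_) key
    rw [tdecode_relCode₁ ⟨sl, hsl⟩ ⟨jk, hjk⟩ idx]
    rfl
  · have hp2 : p = p₂ := by rw [hp]; rfl
    have key := (slice₂_mem_dualModel h₂ hx (decode9 sl)).2 j k r (hp2 ▸ hrmem')
    refine Eq.trans (Finset.sum_congr rfl fun idx _ => ?_) key
    rw [tdecode_relCode₂ ⟨sl, hsl⟩ ⟨jk, hjk⟩ idx]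
    rfl
  · have hp3 : p = p₃ := by rw [hp]; rfl
    have key := (slice₃_mem_dualModel h₃ hx (decode9 sl)).2 j k r (hp3 ▸ hrmem')
    refine Eq.trans (Finset.sum_congr rfl fun idx _ => ?_) key
    rw [tdecode_relCode₃ ⟨sl, hsl⟩ ⟨jk, hjk⟩ idx]
    rfl

end Vanishing

/-! ## Triangular families are independent -/

/-- **A triangular family of sparse functionals bounds the dimension of a subspace it annihilates**:
non-zero coefficient at the own pivot, zero at every later pivot ⇒ `dim T ≤ 729 - #family`
(characteristic `0`). [folklore] -/
theorem finrank_le_of_triangular [CharZero K] (L : List (Ker.TFunc × ℕ))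
    (hcode : ∀ q ∈ L, q.2 < 729 ∧ ∀ e ∈ q.1, e.1 < 729)
    (hdiag : ∀ q ∈ L, Ker.TFunc.coef q.1 q.2 ≠ 0)
    (htri : L.Pairwise fun q q' => Ker.TFunc.coef q.1 q'.2 = 0)
    (T : Submodule K (I9' × I9' × I9' → K)) (hT : ∀ x ∈ T, ∀ q ∈ L, Ker.TFunc.ev q.1 x = 0) :
    Module.finrank K T ≤ 729 - L.length := by
  classical
  set r := L.length with hr
  -- the rows
  let A : Matrix (Fin r) (I9' × I9' × I9') K :=
    Matrix.of fun t y => Ker.TFunc.row (L[(t : ℕ)]).1 y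
  -- the square minor at the pivots: lower triangular with non-zero diagonal
  let M : Matrix (Fin r) (Fin r) K :=
    Matrix.of fun t s => (Ker.TFunc.coef (L[(t : ℕ)]).1 (L[(s : ℕ)]).2 : K)
  have hM : M.BlockTriangular OrderDual.toDual := by
    intro t s hts
    change (Ker.TFunc.coef (L[(t : ℕ)]).1 (L[(s : ℕ)]).2 : K) = 0
    have hlt : (t : ℕ) < s := hts
    rw [List.pairwise_iff_getElem.1 htri t s t.isLt s.isLt hlt, Int.cast_zero]
  have hdet : M.det ≠ 0 := by
    rw [Matrix.det_of_lowerTriangular M hM, Finset.prod_ne_zero_iff]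
    intro t _
    change (Ker.TFunc.coef (L[(t : ℕ)]).1 (L[(t : ℕ)]).2 : K) ≠ 0
    exact Int.cast_ne_zero.2 (hdiag _ (List.getElem_mem t.isLt))
  have hrowM : ∀ t s : Fin r, A t (tdecode (L[(s : ℕ)]).2) = M t s := by
    intro t s
    change Ker.TFunc.row (L[(t : ℕ)]).1 (tdecode (L[(s : ℕ)]).2) =
      (Ker.TFunc.coef (L[(t : ℕ)]).1 (L[(s : ℕ)]).2 : K)
    rw [Ker.TFunc.row, tcode_tdecode (hcode _ (List.getElem_mem s.isLt)).1]
  have hli : LinearIndependent K A.row := by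
    rw [Fintype.linearIndependent_iff]
    intro g hg t
    have hvec : g ᵥ* M = 0 := by
      funext s
      have := congr_fun hg (tdecode (L[(s : ℕ)]).2)
      simp only [Finset.sum_apply, Pi.smul_apply, smul_eq_mul, Pi.zero_apply] at this
      rw [Matrix.vecMul, dotProduct, Pi.zero_apply, ← this]
      exact Finset.sum_congr rfl fun t' _ => by rw [← hrowM]; rfl
    exact congr_fun (Matrix.eq_zero_of_vecMul_eq_zero hdet hvec) t
  have hrank : A.rank = r := by rw [hli.rank_matrix, Fintype.card_fin]
  -- `T ≤ ker A`
  have hker : T ≤ LinearMap.ker A.mulVecLin := by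
    intro x hxT
    rw [LinearMap.mem_ker, Matrix.mulVecLin_apply]
    funext t
    rw [Matrix.mulVec, dotProduct, Pi.zero_apply]
    have := hT x hxT _ (List.getElem_mem t.isLt)
    rw [Ker.TFunc.ev_eq_sum _ (hcode _ (List.getElem_mem t.isLt)).2] at this
    rw [← this]
    rfl
  have hdim := LinearMap.finrank_range_add_finrank_ker A.mulVecLin
  have hV : Module.finrank K (I9' × I9' × I9' → K) = 729 := by
    rw [Module.finrank_fintype_fun_eq_card]; simp [Fintype.card_prod, Fintype.card_fin]
  rw [hV] at hdim
  have hrg : Module.finrank K (LinearMap.range A.mulVecLin) = r := hrank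
  have := Submodule.finrank_mono hker
  omega

/-! ## The checker's guarantees -/

/-- What `triRun` guarantees on a list sorted by weight. [folklore] -/
theorem triRun_spec (φ : Ker.TFunc) (w : ℕ) :
    ∀ l : List (ℕ × Ker.Sel × ℕ), Ker.triRun φ w l = true → l.Pairwise (fun a b => a.1 ≤ b.1) →
      ∀ e ∈ l, w < e.1 ∨ (w = e.1 ∧ φ.coef e.2.2 = 0)
  | [], _, _ => by simp
  | a :: l, h, hs => by
      rw [Ker.triRun] at h
      intro e he
      rw [List.mem_cons] at he
      by_cases ha : a.1 = w
      · rw [if_pos ha, Bool.and_eq_true, beq_iff_eq] at h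
        rcases he with rfl | he
        · exact Or.inr ⟨ha.symm, h.1⟩
        · exact triRun_spec φ w l h.2 hs.of_cons e he
      · rw [if_neg ha, decide_eq_true_eq] at h
        rcases he with rfl | he
        · exact Or.inl h
        · exact Or.inl (lt_of_lt_of_le h (List.rel_of_pairwise_cons hs he))

/-- **`triFlat` guarantees**: later entries are heavier, or of equal weight and annihilated at
their pivot. [folklore] -/
theorem triFlat_pairwise (p₁ p₂ p₃ : List (List (ℕ × ℕ) × ℕ)) :
    ∀ cert : List (ℕ × Ker.Sel × ℕ), Ker.triFlat p₁ p₂ p₃ cert = true →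
      cert.Pairwise fun e e' => e.1 < e'.1 ∨ (e.1 = e'.1 ∧ (e.2.1.toFunc p₁ p₂ p₃).coef e'.2.2 = 0)
  | [], _ => List.Pairwise.nil
  | e :: rest, h => by
      rw [Ker.triFlat, Bool.and_eq_true] at h
      have ih := triFlat_pairwise p₁ p₂ p₃ rest h.2
      refine List.pairwise_cons.2 ⟨fun e' he' => ?_, ih⟩
      have hs : rest.Pairwise (fun a b => a.1 ≤ b.1) :=
        ih.imp fun hab => hab.elim le_of_lt fun h' => le_of_eq h'.1
      exact triRun_spec _ _ rest h.1 hs e' he'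

/-! ## The bound -/

/-- The killed codes, in increasing order. [folklore] -/
def killedList (p₁ p₂ p₃ : List (List (ℕ × ℕ) × ℕ)) : List ℕ := (List.range 729).filter (Ker.killed p₁ p₂ p₃)

/-- The full family: killed unit functionals, then the selected relations. [folklore] -/
def allRows (p₁ p₂ p₃ : List (List (ℕ × ℕ) × ℕ)) (cert : List (ℕ × Ker.Sel × ℕ)) : List (Ker.TFunc × ℕ) :=
  ((killedList p₁ p₂ p₃).map fun s => ([(s, 1)], s)) ++ cert.map fun e => (e.2.1.toFunc p₁ p₂ p₃, e.2.2)

/-- Coefficients of a unit functional. [folklore] -/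
theorem coef_unit (s c : ℕ) : Ker.TFunc.coef [(s, 1)] c = if s = c then 1 else 0 := by
  rw [Ker.TFunc.coef_cons, Ker.TFunc.coef_nil, add_zero]

/-- **Soundness of the `(111)` test procedure**: for `E₁ ≤ dualModel p₁`, `E₂ ∘ σ₂ ≤ dualModel p₂`,
`E₃ ∘ σ₃ ≤ dualModel p₃`, the `(111)`-test space has `dim ≤ Ker.bound111 p₁ p₂ p₃`
(characteristic `0`). [cite: ConnerHarperLandsberg2023, §3 (ii) and §6] -/
theorem finrank_tripleInter_le_bound111 [CharZero K] {p₁ p₂ p₃ : List (List (ℕ × ℕ) × ℕ)}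
    {E₁ E₂ E₃ : Submodule K (I9' × I9' → K)} (h₁ : E₁ ≤ dualModel p₁)
    (h₂ : E₂.map (LinearMap.funLeft K K σ₂) ≤ dualModel p₂)
    (h₃ : E₃.map (LinearMap.funLeft K K σ₃) ≤ dualModel p₃) :
    Module.finrank K (tripleInter E₁ E₂ E₃) ≤ Ker.bound111 p₁ p₂ p₃ := by
  simp only [Ker.bound111]
  split_ifs with hok
  · rw [Ker.certOK111, Bool.and_eq_true, List.all_eq_true] at hok
    obtain ⟨hent, htri⟩ := hok
    set cert := Ker.triSearch p₁ p₂ p₃ with hcert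
    -- facts on entries
    have hent' : ∀ e ∈ cert, Ker.Sel.legit p₁ p₂ p₃ e.2.1 = true ∧ e.2.2 < 729 ∧
        Ker.killed p₁ p₂ p₃ e.2.2 = false ∧ Ker.wT e.2.2 = e.1 ∧
        (∀ y ∈ Ker.Sel.toFunc p₁ p₂ p₃ e.2.1, y.1 < 729 ∧ Ker.wT y.1 = e.1) ∧
        Ker.TFunc.coef (Ker.Sel.toFunc p₁ p₂ p₃ e.2.1) e.2.2 ≠ 0 := by
      intro e he
      have h := hent e he
      simp only [Ker.entryOK, Bool.and_eq_true, decide_eq_true_eq, beq_iff_eq, Bool.not_eq_true',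
        List.all_eq_true, bne_iff_ne] at h
      obtain ⟨⟨⟨⟨⟨hl, hc⟩, hk⟩, hw⟩, hall⟩, hne⟩ := h
      exact ⟨hl, hc, hk, hw, hall, hne⟩
    have hlen : 729 - Ker.killedCount p₁ p₂ p₃ - cert.length = 729 - (allRows p₁ p₂ p₃ cert).length := by
      rw [allRows, List.length_append, List.length_map, List.length_map, Ker.killedCount, killedList]
      omega
    rw [hlen]
    refine finrank_le_of_triangular (allRows p₁ p₂ p₃ cert) ?_ ?_ ?_ _ ?_
    · -- codes `< 729`
      intro q hq
      rw [allRows, List.mem_append, List.mem_map, List.mem_map] at hq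
      rcases hq with ⟨s, hs, rfl⟩ | ⟨e, he, rfl⟩
      · have hs' : s < 729 := List.mem_range.1 (List.mem_filter.1 hs).1
        exact ⟨hs', fun e he => by rw [List.mem_singleton] at he; rw [he]; exact hs'⟩
      · exact ⟨(hent' e he).2.1, fun y hy => ((hent' e he).2.2.2.2.1 y hy).1⟩
    · -- non-zero pivots
      intro q hq
      rw [allRows, List.mem_append, List.mem_map, List.mem_map] at hq
      rcases hq with ⟨s, hs, rfl⟩ | ⟨e, he, rfl⟩
      · change Ker.TFunc.coef [(s, 1)] s ≠ 0
        rw [coef_unit, if_pos rfl]; exact one_ne_zero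
      · exact (hent' e he).2.2.2.2.2
    · -- triangularity
      rw [allRows, List.pairwise_append]
      refine ⟨?_, ?_, ?_⟩
      · refine List.Pairwise.map _ (fun s s' (hss' : s < s') => ?_)
          ((List.pairwise_lt_range (n := 729)).filter _)
        change Ker.TFunc.coef [(s, 1)] s' = 0
        rw [coef_unit, if_neg (Nat.ne_of_lt hss')]
      · refine List.Pairwise.map _ (fun e e' (hee' : e ∈ cert ∧ e' ∈ cert ∧
          (e.1 < e'.1 ∨ (e.1 = e'.1 ∧ (e.2.1.toFunc p₁ p₂ p₃).coef e'.2.2 = 0))) => ?_)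
          ((triFlat_pairwise p₁ p₂ p₃ cert htri).imp_of_mem fun ha hb h => ⟨ha, hb, h⟩)
        obtain ⟨he, he', h⟩ := hee'
        change Ker.TFunc.coef (Ker.Sel.toFunc p₁ p₂ p₃ e.2.1) e'.2.2 = 0
        rcases h with hlt | ⟨-, h0⟩
        · -- different weights: no entry of `e` has the code of the pivot of `e'`
          refine Ker.TFunc.coef_eq_zero_of_forall_ne fun y hy heq => ?_
          have hwy := ((hent' e he).2.2.2.2.1 y hy).2
          have hw' := (hent' e' he').2.2.2.1
          rw [heq] at hwy
          omega
        · exact h0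
      · intro q hq q' hq'
        rw [List.mem_map] at hq hq'
        obtain ⟨s, hs, rfl⟩ := hq
        obtain ⟨e, he, rfl⟩ := hq'
        change Ker.TFunc.coef [(s, 1)] e.2.2 = 0
        rw [coef_unit, if_neg]
        intro hse
        have hks := (List.mem_filter.1 hs).2
        rw [hse, (hent' e he).2.2.1] at hks
        exact Bool.false_ne_true hks
    · -- annihilation
      intro x hx q hq
      rw [allRows, List.mem_append, List.mem_map, List.mem_map] at hq
      rcases hq with ⟨s, hs, rfl⟩ | ⟨e, he, rfl⟩
      · obtain ⟨hs729, hks⟩ := List.mem_filter.1 hs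
        change Ker.TFunc.ev [(s, 1)] x = 0
        simp only [Ker.TFunc.ev, List.map_cons, List.map_nil, List.sum_cons, List.sum_nil, add_zero,
          Int.cast_one, one_mul]
        exact apply_eq_zero_of_killed h₁ h₂ h₃ hx (List.mem_range.1 hs729) hks
      · exact ev_toFunc_eq_zero h₁ h₂ h₃ hx _ (hent' e he).1
  · exact (Submodule.finrank_le _).trans
      (by rw [Module.finrank_fintype_fun_eq_card]; simp [Fintype.card_prod, Fintype.card_fin])

end MatMul3

end BorderApolarity

end Literature.Computability.AlgebraicComplexity
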